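import Mathlib
import Summits.NavierStokesRegularity.NavierStokesRegularity.Theorems.EulerZoomLiouvillePowerGaugeEulerLiouvilleSelfSimilarEndpointDecay
import Summits.NavierStokesRegularity.NavierStokesRegularity.Theorems.EulerZoomLiouvillePowerGaugeEulerLiouvilleSelfSimilarEndpointFluxEE
import HarnessLib

/-!
# Rung C1 of the crux `EulerZoomLiouville.PowerGaugeEulerLiouville` at the endpoint `ρ = 1/2`:
# the energy drain from the shell FLUX INEQUALITY (and from the profile energy EQUALITY)

Route №10 `EulerZoomLiouville` (NavierStokesRegularity), crux E = stmt-NavierStokesRegularity-19832,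
registered open stub `stub_selfSimilarWeakRest`, endpoint `ρ = 1/2`.  The tree's energy drain
`shell_energy_decay_half` (`…SelfSimilarEndpointDecay`) takes the TIME-DEPENDENT forward profile
LEI as input and uses it only through Chae–Shvydkoy's starting inequality (3.2)
(`shell_energy_le_flux_of_profileLEI_half`).  This file re-exports the drain with (3.2) itself as the
hypothesis, so that the test-function route of `…SelfSimilarEndpointFluxEE` (profile local energy
EQUALITY ⇒ (3.2)) — the form available for members self-similar about `(T, x₀)` on a past sub-slab —
feeds the same real-variable iteration:

* `EndpointFlux.shell_energy_decay_half_of_flux` — `V ∈ L² ∩ L³_loc`, `|P||V| ∈ L¹_loc`, (3.2),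
  the Riesz representation of `P` at large scales, sublinear growth `‖V(y)‖ ≤ C_up|y|^{1−δ}` a.e. far
  out ⇒ `∫_{L≤|y|<2L} ‖V‖² ≤ C_ε L^{−5+ε}` for all `L ≥ 1` (the body is the tree's, verbatim after the
  first line — adapted from `…SelfSimilarEndpointDecay`);
* `EndpointFlux.shell_energy_decay_half_of_profileEE` — the same from the profile local energy
  EQUALITY in test-function form (`shell_energy_le_flux_of_profileEE_half`);
* `EndpointFlux.profile_false_half_of_shellLower_of_profileEE` — plus a lower bound
  `c₀ L^{−5+η} ≤ ∫_{L≤|y|<2L}‖V‖²` along radii beyond every bound ⇒ contradiction (profile level).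

WHAT THIS IS NOT: not NS, not E, not the stub — plumbing for the past/shifted endpoint stratum.
[cite: ChaeShvydkoy2013, §3.1 proof of Thm. 3.1; BronziShvydkoy2015, Remark 1.5]
-/

noncomputable section

-- flat `Theorems/<Route><Decl>…` files of one crux share the namespace of the crux (tree convention)
set_option linter.dupNamespace false

open MeasureTheory Set Filter Topology Metric Function Finset
open scoped ENNReal NNReal InnerProductSpace RealInnerProductSpace

namespace Summit.NavierStokesRegularity.NavierStokesRegularity.Theorems.PowerGaugeEulerLiouville

open Literature.Analysis Literature.Analysis.FunctionSpaces Literature.Analysis.FluidPDE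

namespace EndpointFlux

variable {V : EuclideanSpace ℝ (Fin 3) → EuclideanSpace ℝ (Fin 3)} {P : EuclideanSpace ℝ (Fin 3) → ℝ}

/-- **Energy drain of endpoint profiles with sublinear growth, from the shell flux inequality.**
`V ∈ L² ∩ L³_loc`, `|P||V| ∈ L¹_loc`, Chae–Shvydkoy's (3.2)
`∫_{L≤|y|<2L}|V|² ≤ (K/L)∫_{L/4≤|y|≤8L}(|V|³+2|P||V|)` for all `L > 0`, the Riesz representation of `P`
at scales `R ≥ R₁`, and `‖V(y)‖ ≤ C_up|y|^{1−δ}` a.e. on `|y| ≥ R₀` (`0 < δ ≤ 1`) ⇒ for every `ε > 0`,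
`∫_{L≤|y|<2L}|V|² ≤ C L^{−5+ε}` for `L ≥ 1`.  (The tree's `shell_energy_decay_half` with its first line
turned into a hypothesis — adapted from `…SelfSimilarEndpointDecay`.)
[cite: ChaeShvydkoy2013, §3.1 proof of Thm. 3.1; BronziShvydkoy2015, Remark 1.5] -/
theorem shell_energy_decay_half_of_flux
    (hVm : AEStronglyMeasurable V volume) (hV2 : Integrable (fun z => ‖V z‖ ^ 2) volume)
    (hV3 : LocallyIntegrable (fun y => ‖V y‖ ^ 3) volume)
    (hPV : LocallyIntegrable (fun y => |P y| * ‖V y‖) volume)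
    (hflux : ∃ K : ℝ, 0 ≤ K ∧ ∀ L : ℝ, 0 < L →
      ∫ y in {y | L ≤ ‖y‖ ∧ ‖y‖ < 2 * L}, ‖V y‖ ^ 2 ≤
        K / L * ∫ y in {y | L / 4 ≤ ‖y‖ ∧ ‖y‖ ≤ 8 * L}, (‖V y‖ ^ 3 + 2 * (|P y| * ‖V y‖)))
    {R₁ : ℝ}
    (hP : ∀ R : ℝ, R₁ ≤ R → ∀ᵐ y ∂volume, ‖y‖ < R / 2 →
      P y = rieszPressure ((ball (0 : EuclideanSpace ℝ (Fin 3)) R).indicator V) y +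
        ∫ z in {z | R ≤ ‖z‖}, pressureKernel (y - z) (V z))
    {δ Cup R₀ : ℝ} (hδ : 0 < δ) (hδ1 : δ ≤ 1) (hCup : 0 ≤ Cup)
    (hup : ∀ᵐ y ∂volume, R₀ ≤ ‖y‖ → ‖V y‖ ≤ Cup * ‖y‖ ^ (1 - δ))
    {ε : ℝ} (hε : 0 < ε) :
    ∃ C : ℝ, ∀ L : ℝ, 1 ≤ L →
      ∫ y in {y | L ≤ ‖y‖ ∧ ‖y‖ < 2 * L}, ‖V y‖ ^ 2 ≤ C * L ^ (-(5 : ℝ) + ε) := by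
  -- adapted from the tree's `shell_energy_decay_half` (…SelfSimilarEndpointDecay): constants
  obtain ⟨K, hK0, hK⟩ := hflux
  obtain ⟨C_S, hCS⟩ := exists_eLpNorm_rieszPressure_two_le
  set E₂ : ℝ := ∫ z, ‖V z‖ ^ 2 with hE₂
  have hE₂0 : 0 ≤ E₂ := integral_nonneg fun z => by positivity
  set v₁ : ℝ := volume.real (ball (0 : EuclideanSpace ℝ (Fin 3)) 1) with hv₁
  have hv₁0 : 0 ≤ v₁ := measureReal_nonneg
  -- the shell energies and the window sum
  set f : ℝ → ℝ := fun L => ∫ y in {y | L ≤ ‖y‖ ∧ ‖y‖ < 2 * L}, ‖V y‖ ^ 2 with hf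
  set S : ℝ → ℝ := fun L => ∑ k ∈ range (2 * 5 + 1), f (2 ^ k * L / 2 ^ 5) with hS
  have hf0 : ∀ L, 0 < L → 0 ≤ f L := fun L _ =>
    setIntegral_nonneg ((measurableSet_le measurable_const measurable_norm).inter
      (measurableSet_lt measurable_norm measurable_const)) fun y _ => by positivity
  have hfB : ∀ L, 0 < L → f L ≤ E₂ := fun L _ =>
    setIntegral_le_integral hV2 (Eventually.of_forall fun y => by positivity)
  -- the recursion constants
  set C₁ : ℝ := K * Cup * ((8 : ℝ) ^ (1 - δ) + 2 * C_S * (32 : ℝ) ^ (1 - δ)) with hC₁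
  set C₂ : ℝ := K * (4 * E₂ * (512 * Real.sqrt (512 * v₁) / (2 * Real.pi))) with hC₂
  have hC₁0 : 0 ≤ C₁ := by positivity
  have hC₂0 : 0 ≤ C₂ := by positivity
  set L₁ : ℝ := max (8 * R₀) (max (R₁ / 32) 1) with hL₁
  have hL₁1 : 1 ≤ L₁ := le_max_of_le_right (le_max_right _ _)
  have hL₁0 : 0 < L₁ := one_pos.trans_le hL₁1
  -- the recursion
  have hrec : ∀ L, L₁ ≤ L → f L ≤ C₁ * L ^ (-δ) * S L + C₂ * Real.sqrt (S L) * L ^ (-(5 / 2 : ℝ)) := by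
    intro L hLL
    have hL : 0 < L := hL₁0.trans_le hLL
    have hR₀L : R₀ ≤ L / 8 := by
      have : 8 * R₀ ≤ L := (le_max_left _ _).trans hLL
      linarith
    have hR₁L : R₁ ≤ 32 * L := by
      have : R₁ / 32 ≤ L := (le_max_left _ _).trans ((le_max_right _ _).trans hLL)
      linarith
    -- the sets and their energies
    set eS : ℝ := ∫ y in {y | L / 4 ≤ ‖y‖ ∧ ‖y‖ ≤ 8 * L}, ‖V y‖ ^ 2 with heS
    set eT : ℝ := ∫ y in {y | L / 8 ≤ ‖y‖ ∧ ‖y‖ < 32 * L}, ‖V y‖ ^ 2 with heT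
    have hSm : MeasurableSet {y : EuclideanSpace ℝ (Fin 3) | L / 4 ≤ ‖y‖ ∧ ‖y‖ ≤ 8 * L} :=
      (measurableSet_le measurable_const measurable_norm).inter
        (measurableSet_le measurable_norm measurable_const)
    have heS0 : 0 ≤ eS := setIntegral_nonneg hSm fun y _ => by positivity
    have heST : eS ≤ eT :=
      setIntegral_mono_set hV2.integrableOn (Eventually.of_forall fun y => by positivity)
        (Eventually.of_forall fun y hy => ⟨by linarith [hy.1], by linarith [hy.2]⟩)
    have heTS : eT ≤ S L := by
      have := windowSum_ge_setIntegral hV2 hL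
      rw [hS]; exact this
    have heT0 : 0 ≤ eT := heS0.trans heST
    have hSL0 : 0 ≤ S L := heT0.trans heTS
    -- flux lemma
    have h1 := hK L hL
    -- cubic and pressure on the shell
    have hcub := shell_cubic_le hV2 hV3 hδ1 hCup hup (by linarith : R₀ ≤ L / 4)
    have hP32 : ∀ᵐ y ∂volume, ‖y‖ < 16 * L →
        P y = rieszPressure ((ball (0 : EuclideanSpace ℝ (Fin 3)) (32 * L)).indicator V) y +
          ∫ z in {z | 32 * L ≤ ‖z‖}, pressureKernel (y - z) (V z) := by
      filter_upwards [hP (32 * L) hR₁L] with y hy hy16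
      exact hy (by linarith)
    have hpre := shell_pressure_le hCS hVm hV2 hV3 hPV hδ1 hCup hup hL hR₀L hP32
    -- volume of `B̄_{8L}`
    have hvol : volume.real (closedBall (0 : EuclideanSpace ℝ (Fin 3)) (8 * L)) = (8 * L) ^ 3 * v₁ := by
      rw [Measure.addHaar_real_closedBall _ _ (by positivity), finrank_euclideanSpace_fin]
    rw [hvol] at hpre
    -- combine: `f L ≤ (K/L) (cubic + 2 pressure)`
    have hN : (∫ z, ‖V z‖ ^ 2) / (2 * Real.pi * (L / 8) ^ 3) = E₂ * (1 / (2 * Real.pi * (L / 8) ^ 3)) := by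
      rw [hE₂]; ring
    have hstep : f L ≤ K / L * (Cup * (8 * L) ^ (1 - δ) * eS +
        2 * (C_S * (Cup * (32 * L) ^ (1 - δ)) * eT +
          2 * (E₂ * (1 / (2 * Real.pi * (L / 8) ^ 3))) * Real.sqrt ((8 * L) ^ 3 * v₁) *
            Real.sqrt eS)) := by
      refine h1.trans (mul_le_mul_of_nonneg_left ?_ (by positivity))
      rw [integral_add ?_ ?_]
      · rw [integral_const_mul, ← hN]
        exact add_le_add hcub (mul_le_mul_of_nonneg_left hpre (by norm_num))
      · exact (hV3.integrableOn_isCompact (isCompact_closedBall 0 (8 * L))).mono_set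
          fun y hy => by rw [mem_closedBall, dist_zero_right]; exact hy.2
      · exact ((hPV.integrableOn_isCompact (isCompact_closedBall 0 (8 * L))).mono_set
          fun y hy => by rw [mem_closedBall, dist_zero_right]; exact hy.2).const_mul 2
    -- exponent bookkeeping
    have hA : K / L * (Cup * (8 * L) ^ (1 - δ) * eS) = K * Cup * (8 : ℝ) ^ (1 - δ) * L ^ (-δ) * eS := by
      have := mul_rpow_one_sub_div (δ := δ) (by norm_num : (0 : ℝ) < 8) hL
      calc K / L * (Cup * (8 * L) ^ (1 - δ) * eS) = K * Cup * ((8 * L) ^ (1 - δ) / L) * eS := by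
            field_simp
        _ = K * Cup * (8 : ℝ) ^ (1 - δ) * L ^ (-δ) * eS := by rw [this]; ring
    have hB : K / L * (2 * (C_S * (Cup * (32 * L) ^ (1 - δ)) * eT)) =
        2 * K * C_S * Cup * (32 : ℝ) ^ (1 - δ) * L ^ (-δ) * eT := by
      have := mul_rpow_one_sub_div (δ := δ) (by norm_num : (0 : ℝ) < 32) hL
      calc K / L * (2 * (C_S * (Cup * (32 * L) ^ (1 - δ)) * eT))
          = 2 * K * C_S * Cup * ((32 * L) ^ (1 - δ) / L) * eT := by field_simp
        _ = 2 * K * C_S * Cup * (32 : ℝ) ^ (1 - δ) * L ^ (-δ) * eT := by rw [this]; ring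
    have hC : K / L * (2 * (2 * (E₂ * (1 / (2 * Real.pi * (L / 8) ^ 3))) *
        Real.sqrt ((8 * L) ^ 3 * v₁) * Real.sqrt eS)) = C₂ * Real.sqrt eS * L ^ (-(5 / 2 : ℝ)) := by
      have := farField_scaling hL hv₁0
      calc K / L * (2 * (2 * (E₂ * (1 / (2 * Real.pi * (L / 8) ^ 3))) *
            Real.sqrt ((8 * L) ^ 3 * v₁) * Real.sqrt eS))
          = K * (4 * E₂ * (1 / (2 * Real.pi * (L / 8) ^ 3) * Real.sqrt ((8 * L) ^ 3 * v₁) / L)) *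
              Real.sqrt eS := by field_simp; ring
        _ = C₂ * Real.sqrt eS * L ^ (-(5 / 2 : ℝ)) := by rw [this, hC₂]; ring
    have hLδ : 0 < L ^ (-δ) := Real.rpow_pos_of_pos hL _
    have hL52 : 0 < L ^ (-(5 / 2 : ℝ)) := Real.rpow_pos_of_pos hL _
    calc f L ≤ K / L * (Cup * (8 * L) ^ (1 - δ) * eS) +
          K / L * (2 * (C_S * (Cup * (32 * L) ^ (1 - δ)) * eT)) +
          K / L * (2 * (2 * (E₂ * (1 / (2 * Real.pi * (L / 8) ^ 3))) *
            Real.sqrt ((8 * L) ^ 3 * v₁) * Real.sqrt eS)) := by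
          refine hstep.trans (le_of_eq ?_); ring
      _ = K * Cup * (8 : ℝ) ^ (1 - δ) * L ^ (-δ) * eS +
            2 * K * C_S * Cup * (32 : ℝ) ^ (1 - δ) * L ^ (-δ) * eT +
            C₂ * Real.sqrt eS * L ^ (-(5 / 2 : ℝ)) := by rw [hA, hB, hC]
      _ ≤ K * Cup * (8 : ℝ) ^ (1 - δ) * L ^ (-δ) * S L +
            2 * K * C_S * Cup * (32 : ℝ) ^ (1 - δ) * L ^ (-δ) * S L +
            C₂ * Real.sqrt (S L) * L ^ (-(5 / 2 : ℝ)) := by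
          gcongr
          · exact heST.trans heTS
          · exact heST.trans heTS
      _ = C₁ * L ^ (-δ) * S L + C₂ * Real.sqrt (S L) * L ^ (-(5 / 2 : ℝ)) := by
          rw [hC₁]; ring
  -- iterate
  obtain ⟨C, hC⟩ := shell_decay_of_recursion (κ := 5 / 2) (m := 5) hf0 hfB hδ hC₁0 hC₂0 hL₁0
    (fun L => rfl) hrec hε
  refine ⟨C, fun L hL => ?_⟩
  have := hC L hL
  norm_num at this ⊢
  exact this

/-- **Energy drain from the profile local energy EQUALITY** (test-function form at `γ = 2/5`):
`shell_energy_le_flux_of_profileEE_half` + `shell_energy_decay_half_of_flux`.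
[cite: ChaeShvydkoy2013, §3.1 proof of Thm. 3.1] -/
theorem shell_energy_decay_half_of_profileEE
    (hVm : AEStronglyMeasurable V volume) (hV2 : Integrable (fun z => ‖V z‖ ^ 2) volume)
    (hV3 : LocallyIntegrable (fun y => ‖V y‖ ^ 3) volume)
    (hPV : LocallyIntegrable (fun y => |P y| * ‖V y‖) volume)
    {γ : ℝ} (hγ : γ = 2 / 5)
    (hEE : ∀ σ : EuclideanSpace ℝ (Fin 3) → ℝ,
      IsTestFunctionOn (⊤ : TopologicalSpace.Opens (EuclideanSpace ℝ (Fin 3))) σ →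
        (2 - 5 * γ) * ∫ x, σ x * ‖V x‖ ^ 2 =
          (∫ x, (‖V x‖ ^ 2 + 2 * P x) * ⟪V x, gradient σ x⟫) +
            γ * ∫ x, ‖V x‖ ^ 2 * ⟪x, gradient σ x⟫)
    {R₁ : ℝ}
    (hP : ∀ R : ℝ, R₁ ≤ R → ∀ᵐ y ∂volume, ‖y‖ < R / 2 →
      P y = rieszPressure ((ball (0 : EuclideanSpace ℝ (Fin 3)) R).indicator V) y +
        ∫ z in {z | R ≤ ‖z‖}, pressureKernel (y - z) (V z))
    {δ Cup R₀ : ℝ} (hδ : 0 < δ) (hδ1 : δ ≤ 1) (hCup : 0 ≤ Cup)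
    (hup : ∀ᵐ y ∂volume, R₀ ≤ ‖y‖ → ‖V y‖ ≤ Cup * ‖y‖ ^ (1 - δ))
    {ε : ℝ} (hε : 0 < ε) :
    ∃ C : ℝ, ∀ L : ℝ, 1 ≤ L →
      ∫ y in {y | L ≤ ‖y‖ ∧ ‖y‖ < 2 * L}, ‖V y‖ ^ 2 ≤ C * L ^ (-(5 : ℝ) + ε) :=
  shell_energy_decay_half_of_flux hVm hV2 hV3 hPV
    (shell_energy_le_flux_of_profileEE_half hγ hV2.locallyIntegrable hV3 hPV hEE) hP hδ hδ1 hCup hup hε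

/-- **Profile-level endpoint Liouville from the energy EQUALITY and a shell lower bound**: under the
hypotheses of `shell_energy_decay_half_of_profileEE`, a lower bound `c₀ L^{−5+η} ≤ ∫_{L≤|y|<2L}‖V‖²`
(`c₀, η > 0`) along radii beyond every bound is contradictory. [cite: ChaeShvydkoy2013, §3.1 Thm. 3.1] -/
theorem profile_false_half_of_shellLower_of_profileEE
    (hVm : AEStronglyMeasurable V volume) (hV2 : Integrable (fun z => ‖V z‖ ^ 2) volume)
    (hV3 : LocallyIntegrable (fun y => ‖V y‖ ^ 3) volume)
    (hPV : LocallyIntegrable (fun y => |P y| * ‖V y‖) volume)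
    {γ : ℝ} (hγ : γ = 2 / 5)
    (hEE : ∀ σ : EuclideanSpace ℝ (Fin 3) → ℝ,
      IsTestFunctionOn (⊤ : TopologicalSpace.Opens (EuclideanSpace ℝ (Fin 3))) σ →
        (2 - 5 * γ) * ∫ x, σ x * ‖V x‖ ^ 2 =
          (∫ x, (‖V x‖ ^ 2 + 2 * P x) * ⟪V x, gradient σ x⟫) +
            γ * ∫ x, ‖V x‖ ^ 2 * ⟪x, gradient σ x⟫)
    {R₁ : ℝ}
    (hP : ∀ R : ℝ, R₁ ≤ R → ∀ᵐ y ∂volume, ‖y‖ < R / 2 →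
      P y = rieszPressure ((ball (0 : EuclideanSpace ℝ (Fin 3)) R).indicator V) y +
        ∫ z in {z | R ≤ ‖z‖}, pressureKernel (y - z) (V z))
    {δ Cup R₀ : ℝ} (hδ : 0 < δ) (hδ1 : δ ≤ 1) (hCup : 0 ≤ Cup)
    (hup : ∀ᵐ y ∂volume, R₀ ≤ ‖y‖ → ‖V y‖ ≤ Cup * ‖y‖ ^ (1 - δ))
    {c₀ η : ℝ} (hc₀ : 0 < c₀) (hη : 0 < η)
    (hlow : ∀ L₁ : ℝ, ∃ L : ℝ, L₁ ≤ L ∧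
      c₀ * L ^ (-(5 : ℝ) + η) ≤
        ∫ y in {y : EuclideanSpace ℝ (Fin 3) | L ≤ ‖y‖ ∧ ‖y‖ < 2 * L}, ‖V y‖ ^ 2) : False := by
  -- adapted from `EndpointSpread.selfSimilar_half_false_of_shellLower` (same real-variable endgame)
  obtain ⟨C, hC⟩ := shell_energy_decay_half_of_profileEE hVm hV2 hV3 hPV hγ hEE hP hδ hδ1 hCup hup
    (half_pos hη)
  have hkey : ∀ L : ℝ, 1 ≤ L →
      c₀ * L ^ (-(5 : ℝ) + η) ≤
        ∫ y in {y : EuclideanSpace ℝ (Fin 3) | L ≤ ‖y‖ ∧ ‖y‖ < 2 * L}, ‖V y‖ ^ 2 →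
      c₀ * L ^ (η / 2) ≤ C := by
    intro L hL1 hL
    have hL0 : 0 < L := one_pos.trans_le hL1
    have h1 : c₀ * L ^ (-(5 : ℝ) + η) ≤ C * L ^ (-(5 : ℝ) + η / 2) := hL.trans (hC L hL1)
    have h2 := mul_le_mul_of_nonneg_right h1 (Real.rpow_pos_of_pos hL0 (5 - η / 2)).le
    have e1 : c₀ * L ^ (-(5 : ℝ) + η) * L ^ (5 - η / 2) = c₀ * L ^ (η / 2) := by
      rw [mul_assoc, ← Real.rpow_add hL0]; ring_nf
    have e2 : C * L ^ (-(5 : ℝ) + η / 2) * L ^ (5 - η / 2) = C := by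
      rw [mul_assoc, ← Real.rpow_add hL0, show -(5 : ℝ) + η / 2 + (5 - η / 2) = 0 by ring,
        Real.rpow_zero, mul_one]
    rwa [e1, e2] at h2
  have hev : ∀ᶠ L : ℝ in atTop, C / c₀ < L ^ (η / 2) :=
    (tendsto_rpow_atTop (half_pos hη)).eventually_gt_atTop (C / c₀)
  obtain ⟨L₁, hL₁⟩ := (hev.and (eventually_ge_atTop (1 : ℝ))).exists_forall_of_atTop
  obtain ⟨L, hLL₁, hL⟩ := hlow L₁
  have h := hkey L (hL₁ L hLL₁).2 hL
  have h' := (hL₁ L hLL₁).1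
  rw [div_lt_iff₀ hc₀] at h'
  linarith [mul_comm c₀ (L ^ (η / 2))]

end EndpointFlux

end Summit.NavierStokesRegularity.NavierStokesRegularity.Theorems.PowerGaugeEulerLiouville

end
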